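import Summits.KontsevichZagierPeriods.KontsevichZagierPeriods.Theorems.ReducedPeriodRing.Negative.Certificates

/-!
# `ReducedPeriodRing` (stmt-KontsevichZagierPeriods-3929) — integer-valued invariants vanish identically

Negative knowledge for the crux, a corollary of the divisibility of `P = FormalRep ⧸ relations`
(`exists_sub_nsmul_mem_relations`, `Negative/Certificates.lean`) complementing
`bounded_exponent_certificate_vanishes` there: a move-invariant additive functional with values in
a group WITHOUT non-zero infinitely divisible elements vanishes IDENTICALLY — not only on
square-zero candidates. This covers `ℤ`, lattices `ι → ℤ`, and every subgroup of such (finitely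
generated free groups, `ℤ`-valued "counting" data):

* `divisibleFree_certificate_vanishes` — the general statement;
* `int_noDivisible`, `int_certificate_vanishes` — every additive `φ : FormalRep →+ ℤ` killing
  `KZ.relations` is `0`;
* `intPi_certificate_vanishes` — the same for lattice-valued `φ : FormalRep →+ (ι → ℤ)`.

So no integer-valued invariant of the (domain, integrand) data — Euler characteristics of domains
or of fibres, lattice-point counts, degrees, intersection or linking numbers, signed counts of
cells of a decomposition — survives the four moves at all, let alone certifies a nilpotent: with
`Negative/Certificates.lean` (bounded exponent, multiplicative-into-reduced, eval-factoring) and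
`Negative/{Dominated,Bounded}Certificates.lean`, `Negative/PositiveInvariants.lean` (bounded /
dominated / positive real functionals are multiples of `eval`), a certificate against the crux is
a divisible-valued, sign-changing, nowhere volume-bounded additive functional.
Lead c9, `--supports stmt-KontsevichZagierPeriods-3929`; no definitions, no named facts.
[Kontsevich–Zagier 2001, §1.2 rule (1)]
-/

noncomputable section

namespace Summit.KontsevichZagierPeriods.KontsevichZagierPeriods.ReducedPeriodRingNegative

open Literature.NumberTheory.Transcendental KZ

/-- **Invariants with values in a group without divisible elements vanish identically.** If every
infinitely divisible element of `A` is `0`, then every additive `φ : FormalRep →+ A` killing the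
relations is `0` on every class: `c ∼ N • c'` for every `N ≥ 1` (`exists_sub_nsmul_mem_relations`),
so `φ c` is infinitely divisible. [Kontsevich–Zagier 2001, §1.2 rule (1)] -/
theorem divisibleFree_certificate_vanishes {A : Type*} [AddCommGroup A]
    (hA : ∀ a : A, (∀ N : ℕ, 0 < N → ∃ b : A, a = N • b) → a = 0)
    (φ : FormalRep →+ A) (hφ : ∀ c ∈ relations, φ c = 0) (c : FormalRep) : φ c = 0 := by
  refine hA _ fun N hN => ?_
  obtain ⟨c', h⟩ := exists_sub_nsmul_mem_relations c hN
  refine ⟨φ c', ?_⟩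
  have h0 : φ (c - N • c') = 0 := hφ _ h
  rwa [map_sub, map_nsmul, sub_eq_zero] at h0

/-- `ℤ` has no non-zero infinitely divisible element (`a = (|a| + 1) • b` forces `a = 0`).
[folklore] -/
theorem int_noDivisible (a : ℤ) (h : ∀ N : ℕ, 0 < N → ∃ b : ℤ, a = N • b) : a = 0 := by
  by_contra ha
  obtain ⟨b, hb⟩ := h (a.natAbs + 1) (Nat.succ_pos _)
  rw [nsmul_eq_mul] at hb
  push_cast at hb
  have hb0 : b ≠ 0 := by
    rintro rfl
    exact ha (by simpa using hb)
  have h1 : |a| = (|a| + 1) * |b| := by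
    conv_lhs => rw [hb]
    rw [abs_mul, abs_of_nonneg (by positivity : (0 : ℤ) ≤ |a| + 1)]
  have h2 : 1 ≤ |b| := Int.one_le_abs hb0
  nlinarith [abs_nonneg a]

/-- **Every `ℤ`-valued move-invariant additive functional is zero.** In particular no integer-valued
invariant of the data (Euler characteristics, lattice-point counts, degrees, signed cell counts)
can be a certificate against the crux or against Conjecture 1. [Kontsevich–Zagier 2001, §1.2] -/
theorem int_certificate_vanishes (φ : FormalRep →+ ℤ) (hφ : ∀ c ∈ relations, φ c = 0) : φ = 0 :=
  AddMonoidHom.ext fun c => divisibleFree_certificate_vanishes int_noDivisible φ hφ c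

/-- **Every lattice-valued move-invariant additive functional is zero** (`φ : FormalRep →+ (ι → ℤ)`,
coordinatewise). [Kontsevich–Zagier 2001, §1.2] -/
theorem intPi_certificate_vanishes {ι : Type*} (φ : FormalRep →+ (ι → ℤ))
    (hφ : ∀ c ∈ relations, φ c = 0) : φ = 0 := by
  refine AddMonoidHom.ext fun c => funext fun i => ?_
  have h := int_certificate_vanishes ((Pi.evalAddMonoidHom (fun _ : ι => ℤ) i).comp φ)
    (fun d hd => by rw [AddMonoidHom.comp_apply, hφ d hd, map_zero])
  have := DFunLike.congr_fun h c
  simpa using this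

end Summit.KontsevichZagierPeriods.KontsevichZagierPeriods.ReducedPeriodRingNegative
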